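import Summits.KontsevichZagierPeriods.KontsevichZagierPeriods.Theorems.RootDecompRationalCubeDichotomyRankDescentP15

/-! # `RootDecompRationalCubeDichotomyRankDescentP16` — part 2/9 of the mechanical ≤400-line split of `RankDescent_delta_v12_to_v14h_P15plus.lean` (sha256 311877f354eea7b0…)
Source: decomp-kz lens-2 g15 RankDescent_delta_v12_to_v14h_P15plus.lean @311877f3 (critic CLEARED g7-6 l.1400: 26322 ⟺ LetterDegenerateKernel, GenericKernel THEOREM); --supports stmt-KontsevichZagierPeriods-26322.
Split by census-1 g10 `gen/splitlean.py`: scopes re-opened with their `open`/`variable`/`set_option` context; mathematics and declaration order unchanged. -/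

noncomputable section
open MeasureTheory Set MvPolynomial
open Literature.NumberTheory.Transcendental
open Literature.NumberTheory.Transcendental.KZ
namespace Summit.KontsevichZagierPeriods.RootDecompRationalCubeDichotomy.Rung26322.RankDescent
variable {M : ℕ}
open MeasureTheory Set MvPolynomial in
open Literature.NumberTheory.Transcendental in
open Literature.NumberTheory.Transcendental.KZ in
open MeasureTheory Set MvPolynomial in
open Literature.NumberTheory.Transcendental in
open Literature.NumberTheory.Transcendental.KZ in
/-- Soundness: congruent formal combinations have equal values. [cite: KontsevichZagier2001, §1.2] -/
private theorem eval_eq_of_sub_mem {x y : FormalRep} (h : x - y ∈ relations) : eval x = eval y := by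
  have h' := relations_le_ker_eval_holds h
  rw [AddMonoidHom.mem_ker, map_sub] at h'
  exact sub_eq_zero.1 h'

section Diophantine
variable {n : ℕ}
variable (q₀ : ℚ) (hq : 0 < q₀ ∨ q₀ < -1)

/-- **Exact numerators descend INSIDE the tower, as formal representations.** If
`P · (q₀ + ∏ xᵢ) = Σ_k (∂_k G_k · Q − G_k ∂_k Q)` then `[P/Q] ≡ [mergedNum G / (q₀ + ∏_{i<n} xᵢ)]`.
[cite: KontsevichZagier2001, §1.2 rules (1),(3)] -/
theorem fh_exact_rel (P : MvPolynomial (Fin (n + 1)) ℚ) (G : Fin (n + 1) → MvPolynomial (Fin (n + 1)) ℚ)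
    (hG : P * fhQ (n + 1) q₀ = ∑ k, exS (fhQ (n + 1) q₀) k (G k)) :
    KZ.of (fhR q₀ hq (n + 1) P).rep - KZ.of (fhR q₀ hq n (mergedNum q₀ n G)).rep ∈ KZ.relations := by
  have hid : (fhR q₀ hq (n + 1) P).num * (fhR q₀ hq (n + 1) P).den ^ (0 + 1) =
      ∑ k, (pderiv k (G k) * (fhR q₀ hq (n + 1) P).den
        - C (((0 : ℕ) : ℚ) + 1) * (G k * pderiv k (fhR q₀ hq (n + 1) P).den)) := by
    show P * fhQ (n + 1) q₀ ^ (0 + 1) =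
      ∑ k, (pderiv k (G k) * fhQ (n + 1) q₀ - C (((0 : ℕ) : ℚ) + 1) * (G k * pderiv k (fhQ (n + 1) q₀)))
    rw [sum_exS_eq, ← hG, zero_add, pow_one]
  have h1 := descent_rel_exact (fhR q₀ hq (n + 1) P) 0 G hid
  -- identify every face with a member of the tower one dimension down
  have h2 : ∑ k, ((KZ.of ((Wp (fhR q₀ hq (n + 1) P) 0 (G k)).faceAt k 1 zero_le_one_and).rep
      - KZ.of (fhR q₀ hq n (bind₁ (insX k 1) (G k))).rep)
      - (KZ.of ((Wp (fhR q₀ hq (n + 1) P) 0 (G k)).faceAt k 0 le_rfl_and).rep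
        - KZ.of (fhR q₀ hq n (C q₀⁻¹ * bind₁ (insX k 0) (G k) * fhQ n q₀)).rep)) ∈ KZ.relations :=
    sum_mem fun k _ => sub_mem (RFun.rel_of_eqOn fun x hx => face_one_fn q₀ hq P (G k) k x hx)
      (RFun.rel_of_eqOn fun x hx => face_zero_fn q₀ hq P (G k) k x hx)
  -- merge the numerators
  have h3 : KZ.of (fhR q₀ hq n (mergedNum q₀ n G)).rep
      - ∑ k, (KZ.of (fhR q₀ hq n (bind₁ (insX k 1) (G k))).rep
        - KZ.of (fhR q₀ hq n (C q₀⁻¹ * bind₁ (insX k 0) (G k) * fhQ n q₀)).rep) ∈ KZ.relations := by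
    have ha := fhR_rel_sum q₀ hq Finset.univ
      (fun k => bind₁ (insX k 1) (G k) - C q₀⁻¹ * bind₁ (insX k 0) (G k) * fhQ n q₀)
    have hb : ∑ k, (KZ.of (fhR q₀ hq n (bind₁ (insX k 1) (G k) - C q₀⁻¹ * bind₁ (insX k 0) (G k) * fhQ n q₀)).rep
        - (KZ.of (fhR q₀ hq n (bind₁ (insX k 1) (G k))).rep
          - KZ.of (fhR q₀ hq n (C q₀⁻¹ * bind₁ (insX k 0) (G k) * fhQ n q₀)).rep)) ∈ KZ.relations :=
      sum_mem fun k _ => fhR_rel_sub q₀ hq _ _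
    have heq : KZ.of (fhR q₀ hq n (mergedNum q₀ n G)).rep
        - ∑ k, (KZ.of (fhR q₀ hq n (bind₁ (insX k 1) (G k))).rep
          - KZ.of (fhR q₀ hq n (C q₀⁻¹ * bind₁ (insX k 0) (G k) * fhQ n q₀)).rep)
        = (KZ.of (fhR q₀ hq n (mergedNum q₀ n G)).rep
          - ∑ k, KZ.of (fhR q₀ hq n (bind₁ (insX k 1) (G k) - C q₀⁻¹ * bind₁ (insX k 0) (G k) * fhQ n q₀)).rep)
          + ∑ k, (KZ.of (fhR q₀ hq n (bind₁ (insX k 1) (G k) - C q₀⁻¹ * bind₁ (insX k 0) (G k) * fhQ n q₀)).rep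
            - (KZ.of (fhR q₀ hq n (bind₁ (insX k 1) (G k))).rep
              - KZ.of (fhR q₀ hq n (C q₀⁻¹ * bind₁ (insX k 0) (G k) * fhQ n q₀)).rep)) := by
      simp only [Finset.sum_sub_distrib]; abel
    rw [heq]
    exact add_mem ha hb
  have heq : KZ.of (fhR q₀ hq (n + 1) P).rep - KZ.of (fhR q₀ hq n (mergedNum q₀ n G)).rep
      = (KZ.of (fhR q₀ hq (n + 1) P).rep
          - ∑ k, (KZ.of ((Wp (fhR q₀ hq (n + 1) P) 0 (G k)).faceAt k 1 zero_le_one_and).rep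
            - KZ.of ((Wp (fhR q₀ hq (n + 1) P) 0 (G k)).faceAt k 0 le_rfl_and).rep))
        + ∑ k, ((KZ.of ((Wp (fhR q₀ hq (n + 1) P) 0 (G k)).faceAt k 1 zero_le_one_and).rep
            - KZ.of (fhR q₀ hq n (bind₁ (insX k 1) (G k))).rep)
          - (KZ.of ((Wp (fhR q₀ hq (n + 1) P) 0 (G k)).faceAt k 0 le_rfl_and).rep
            - KZ.of (fhR q₀ hq n (C q₀⁻¹ * bind₁ (insX k 0) (G k) * fhQ n q₀)).rep))
        - (KZ.of (fhR q₀ hq n (mergedNum q₀ n G)).rep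
          - ∑ k, (KZ.of (fhR q₀ hq n (bind₁ (insX k 1) (G k))).rep
            - KZ.of (fhR q₀ hq n (C q₀⁻¹ * bind₁ (insX k 0) (G k) * fhQ n q₀)).rep)) := by
    simp only [Finset.sum_sub_distrib]; abel
  rw [heq]
  exact sub_mem (add_mem h1 h2) h3

/-- **Exact numerators: the VALUE descends inside the tower.** [folklore] -/
theorem fhV_exact_descent (P : MvPolynomial (Fin (n + 1)) ℚ) (G : Fin (n + 1) → MvPolynomial (Fin (n + 1)) ℚ)
    (hG : P * fhQ (n + 1) q₀ = ∑ k, exS (fhQ (n + 1) q₀) k (G k)) :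
    fhV q₀ hq (n + 1) P = fhV q₀ hq n (mergedNum q₀ n G) := by
  unfold fhV
  rw [← eval_of, ← eval_of]
  exact eval_eq_of_sub_mem (fh_exact_rel q₀ hq P G hG)

/-- **The top letter splits off with the pure-diagonal functional as coefficient**:
`∫ P/(q₀ + ∏xᵢ) = Λ(P)·L_{n+1} + ∫ (P − Λ(P))/(q₀ + ∏xᵢ)`, the second numerator `s = 0`-exact (§9). [folklore] -/
theorem fhV_split (P : MvPolynomial (Fin (n + 1)) ℚ) :
    fhV q₀ hq (n + 1) P
      = diagAltm q₀ P * letter q₀ hq (n + 1) + fhV q₀ hq (n + 1) (P - C (diagAltm q₀ P)) := by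
  conv_lhs => rw [show P = C (diagAltm q₀ P) * 1 + (P - C (diagAltm q₀ P)) by ring]
  rw [fhV_add, fhV_C_mul, letter]

/-! ### The span of the letters and the Diophantine input -/

/-- `v ∈ ℚ + ℚ·L_1(q₀) + ⋯ + ℚ·L_n(q₀)`. [folklore] -/
def InSpan (n : ℕ) (v : ℝ) : Prop :=
  ∃ (c₀ : ℚ) (c : Fin n → ℚ), v = c₀ + ∑ j : Fin n, (c j : ℝ) * letter q₀ hq ((j : ℕ) + 1)

/-- **THE DIOPHANTINE INPUT.** `1, L_1(q₀), …, L_n(q₀)` are linearly independent over `ℚ`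
(⟺ `1, Li_1(−1/q₀), …, Li_n(−1/q₀)` are). A THEOREM for `q₀ ∈ ℤ` with `log|q₀| > log E(n)`
[Hata 1990, Cor. 2.2: `n = 2`: `|q₀| ≥ 12`, `n = 3`: `|q₀| ≥ 1038`, `n = 4`: `|q₀| ≥ 797102`; DHK quote Hata's `b > 0` version, his `b < 0`
bounds — our `q₀ > 0` — being slightly better] and for
`n = 2`, `q₀ ≥ 5 ∨ q₀ ≤ −6` [Hata 1993; Rhin–Viola 2005, 2019 §5]; OPEN at `q₀ = 1`. Used as a
hypothesis BY NAME; never asserted. [folklore] -/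
def LettersLinIndep (n : ℕ) : Prop :=
  ∀ (c₀ : ℚ) (c : Fin n → ℚ),
    (c₀ : ℝ) + ∑ j : Fin n, (c j : ℝ) * letter q₀ hq ((j : ℕ) + 1) = 0 → c₀ = 0 ∧ c = 0

/-- Auxiliary step `inSpan_rat`: in Span rat. [bookkeeping] -/
theorem inSpan_rat (c : ℚ) : InSpan q₀ hq n c := ⟨c, 0, by simp⟩

/-- Auxiliary step `add`: add. [bookkeeping] -/
theorem InSpan.add {v w : ℝ} (hv : InSpan q₀ hq n v) (hw : InSpan q₀ hq n w) : InSpan q₀ hq n (v + w) := by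
  obtain ⟨a₀, a, rfl⟩ := hv
  obtain ⟨b₀, b, rfl⟩ := hw
  refine ⟨a₀ + b₀, a + b, ?_⟩
  simp only [Pi.add_apply, Rat.cast_add, add_mul, Finset.sum_add_distrib]
  ring

/-- Auxiliary step `smul`: smul. [bookkeeping] -/
theorem InSpan.smul {v : ℝ} (a : ℚ) (hv : InSpan q₀ hq n v) : InSpan q₀ hq n (a * v) := by
  obtain ⟨c₀, c, rfl⟩ := hv
  refine ⟨a * c₀, fun j => a * c j, ?_⟩
  simp only [Rat.cast_mul, mul_add, Finset.mul_sum, mul_assoc]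

/-- Auxiliary step `sub`: sub. [bookkeeping] -/
theorem InSpan.sub {v w : ℝ} (hv : InSpan q₀ hq n v) (hw : InSpan q₀ hq n w) : InSpan q₀ hq n (v - w) := by
  have := (hw.smul q₀ hq (-1)).add q₀ hq hv
  simp only [Rat.cast_neg, Rat.cast_one, neg_mul, one_mul] at this
  rwa [sub_eq_add_neg, add_comm]

/-- Auxiliary step `sum`: sum. [bookkeeping] -/
theorem InSpan.sum {ι : Type*} (s : Finset ι) (f : ι → ℝ) (h : ∀ i ∈ s, InSpan q₀ hq n (f i)) :
    InSpan q₀ hq n (∑ i ∈ s, f i) := by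
  classical
  induction s using Finset.induction_on with
  | empty => rw [Finset.sum_empty]; simpa using inSpan_rat q₀ hq (n := n) 0
  | insert i s hi ih =>
    rw [Finset.sum_insert hi]
    exact (h i (Finset.mem_insert_self i s)).add q₀ hq
      (ih fun j hj => h j (Finset.mem_insert_of_mem hj))

/-- One more letter allowed. [folklore] -/
theorem InSpan.mono {v : ℝ} (hv : InSpan q₀ hq n v) : InSpan q₀ hq (n + 1) v := by
  obtain ⟨c₀, c, rfl⟩ := hv
  refine ⟨c₀, Fin.snoc (α := fun _ => ℚ) c 0, ?_⟩
  rw [Fin.sum_univ_castSucc]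
  simp [Fin.snoc_castSucc, Fin.snoc_last]

/-- Auxiliary step `inSpan_mul_letter_top`: in Span mul letter top. [bookkeeping] -/
theorem inSpan_mul_letter_top (a : ℚ) : InSpan q₀ hq (n + 1) (a * letter q₀ hq (n + 1)) := by
  refine ⟨0, Fin.snoc (α := fun _ => ℚ) 0 a, ?_⟩
  rw [Fin.sum_univ_castSucc]
  simp [Fin.snoc_castSucc, Fin.snoc_last]

/-- Independence of `1, L_1, …, L_{n+1}` contains that of `1, L_1, …, L_n`. [folklore] -/
theorem lettersLinIndep_mono (h : LettersLinIndep q₀ hq (n + 1)) : LettersLinIndep q₀ hq n := by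
  intro c₀ c hc
  have h' : (c₀ : ℝ) + ∑ j : Fin (n + 1),
      ((Fin.snoc (α := fun _ => ℚ) c 0 : Fin (n + 1) → ℚ) j : ℝ) * letter q₀ hq ((j : ℕ) + 1) = 0 := by
    rw [Fin.sum_univ_castSucc]
    simpa [Fin.snoc_castSucc, Fin.snoc_last] using hc
  obtain ⟨h0, h1⟩ := h c₀ _ h'
  refine ⟨h0, funext fun j => ?_⟩
  have := congrFun h1 (Fin.castSucc j)
  simpa [Fin.snoc_castSucc] using this

/-- Extraction of the top coefficient. [folklore] -/
theorem top_coeff_eq_zero (h : LettersLinIndep q₀ hq (n + 1)) {v : ℝ} (hv : InSpan q₀ hq n v) (a : ℚ)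
    (h0 : a * letter q₀ hq (n + 1) + v = 0) : a = 0 := by
  obtain ⟨c₀, c, rfl⟩ := hv
  have h' : (c₀ : ℝ) + ∑ j : Fin (n + 1),
      ((Fin.snoc (α := fun _ => ℚ) c a : Fin (n + 1) → ℚ) j : ℝ) * letter q₀ hq ((j : ℕ) + 1) = 0 := by
    rw [Fin.sum_univ_castSucc]
    simp only [Fin.snoc_castSucc, Fin.snoc_last, Fin.val_castSucc, Fin.val_last]
    linarith
  have := congrFun (h c₀ _ h').2 (Fin.last n)
  simpa [Fin.snoc_last] using this

/-- The sharper input for the TOP residual alone: the top letter is NEW,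
`L_{n+1}(q₀) ∉ ℚ + ℚ·L_1(q₀) + ⋯ + ℚ·L_n(q₀)` (for `n = 1`, `Q = q₀ + xy`: `Li_2(−1/q₀) ∉ ℚ + ℚ·log(1 + 1/q₀)`,
a THEOREM for integers `q₀ ≥ 5 ∨ q₀ ≤ −6` [Hata 1993; Rhin–Viola 2019 §5]). [folklore] -/
def TopLetterNew (n : ℕ) : Prop := ¬ InSpan q₀ hq n (letter q₀ hq (n + 1))

/-- Auxiliary step `topLetterNew_of_linIndep`: top Letter New of lin Indep. [bookkeeping] -/
theorem topLetterNew_of_linIndep (h : LettersLinIndep q₀ hq (n + 1)) : TopLetterNew q₀ hq n := by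
  intro hs
  have h1 := top_coeff_eq_zero q₀ hq h (hs.smul q₀ hq (-1)) 1 (by push_cast; ring)
  exact one_ne_zero h1

/-- Extraction of the top coefficient from the newness of the top letter alone. [folklore] -/
theorem top_coeff_eq_zero_of_new (h : TopLetterNew q₀ hq n) {v : ℝ} (hv : InSpan q₀ hq n v) (a : ℚ)
    (h0 : a * letter q₀ hq (n + 1) + v = 0) : a = 0 := by
  by_contra ha
  apply h
  have ha' : (a : ℝ) ≠ 0 := by exact_mod_cast ha
  have : letter q₀ hq (n + 1) = ((-a⁻¹ : ℚ) : ℝ) * v := by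
    have hv' : v = -(a * letter q₀ hq (n + 1)) := by linarith
    rw [hv', Rat.cast_neg, Rat.cast_inv]
    field_simp
  rw [this]
  exact hv.smul q₀ hq _

/-! ### THEOREM A: the values of the tower are spanned by the letters -/

/-- **THEOREM A.** `∫_{[0,1]^n} P/(q₀ + x₀⋯x_{n-1}) ∈ ℚ + ℚ·L_1(q₀) + ⋯ + ℚ·L_n(q₀)` for every `P ∈ ℚ[x]`.
[folklore] -/
theorem fhV_inSpan : ∀ (n : ℕ) (P : MvPolynomial (Fin n) ℚ), InSpan q₀ hq n (fhV q₀ hq n P)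
  | 0, P => by
    obtain ⟨c, hc⟩ := fhV_zero_rational q₀ hq P
    rw [hc]
    exact inSpan_rat q₀ hq c
  | n + 1, P => by
    rw [fhV_split]
    refine (inSpan_mul_letter_top q₀ hq _).add q₀ hq ?_
    obtain ⟨G, hG⟩ := mem_ex0m_iff.mp (sub_C_diagAltm_mem q₀ P)
    rw [fhV_exact_descent q₀ hq _ G hG]
    exact (fhV_inSpan n _).mono q₀ hq

/-- **THEOREM A, top coefficient.** After splitting off `Λ(P)·L_{n+1}` the rest needs no `L_{n+1}`.
[folklore] -/
theorem fhV_top (P : MvPolynomial (Fin (n + 1)) ℚ) :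
    InSpan q₀ hq n (fhV q₀ hq (n + 1) (P - C (diagAltm q₀ P))) := by
  obtain ⟨G, hG⟩ := mem_ex0m_iff.mp (sub_C_diagAltm_mem q₀ P)
  rw [fhV_exact_descent q₀ hq _ G hG]
  exact fhV_inSpan q₀ hq n _

/-- Under the Diophantine input, value `0` FORCES the de Rham class to vanish: `Λ(P) = 0`. [folklore] -/
theorem diagAltm_eq_zero_of_value (hL : LettersLinIndep q₀ hq (n + 1)) (P : MvPolynomial (Fin (n + 1)) ℚ)
    (h0 : fhV q₀ hq (n + 1) P = 0) : diagAltm q₀ P = 0 :=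
  top_coeff_eq_zero q₀ hq hL (fhV_top q₀ hq P) _ (by rw [← fhV_split]; exact h0)

/-- The same from the newness of the top letter alone. [folklore] -/
theorem diagAltm_eq_zero_of_value_of_new (hN : TopLetterNew q₀ hq n) (P : MvPolynomial (Fin (n + 1)) ℚ)
    (h0 : fhV q₀ hq (n + 1) P = 0) : diagAltm q₀ P = 0 :=
  top_coeff_eq_zero_of_new q₀ hq hN (fhV_top q₀ hq P) _ (by rw [← fhV_split]; exact h0)

/-- Conversely, a tower representation of value `0` with `Λ(P) ≠ 0` EXHIBITS the top letter in the span
of the lower ones: the residual of §9 is live exactly where the Diophantine statement fails. [folklore] -/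
theorem topLetter_inSpan_of_witness (P : MvPolynomial (Fin (n + 1)) ℚ) (hP : diagAltm q₀ P ≠ 0)
    (h0 : fhV q₀ hq (n + 1) P = 0) : InSpan q₀ hq n (letter q₀ hq (n + 1)) := by
  by_contra hN
  exact hP (diagAltm_eq_zero_of_value_of_new q₀ hq hN P h0)

/-! ### THEOREM B: the Diophantine decision of the tower -/

/-- **THEOREM B.** If `1, L_1(q₀), …, L_n(q₀)` are ℚ-linearly independent, every tower representation
`[ [0,1]^n, P/(q₀ + x₀⋯x_{n-1}) ]` of value `0` is `≡ 0` in KZ's rules (`N = 0`), for EVERY numerator `P`.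
Induction down the tower: value `0` ⟹ `Λ(P) = 0` ⟹ `P ∈ Ex0m` ⟹ descend to `mergedNum` one
dimension down (same value `0`, fewer letters) ⟹ … ⟹ dimension `0` (`value 0 ⟹ ≡ 0`, §2).
[folklore] -/
theorem fh_decided : ∀ (n : ℕ), LettersLinIndep q₀ hq n →
    ∀ P : MvPolynomial (Fin n) ℚ, fhV q₀ hq n P = 0 → KZ.of (fhR q₀ hq n P).rep ∈ KZ.relations
  | 0, _, P, h0 => rep_mem_relations_of_dim_le_one (Nat.zero_le 1) _ h0
  | n + 1, hL, P, h0 => by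
    have hΛ := diagAltm_eq_zero_of_value q₀ hq hL P h0
    have hex := sub_C_diagAltm_mem q₀ P
    rw [hΛ, map_zero, sub_zero] at hex
    obtain ⟨G, hG⟩ := mem_ex0m_iff.mp hex
    have hrel := fh_exact_rel q₀ hq P G hG
    have hM0 : fhV q₀ hq n (mergedNum q₀ n G) = 0 := by rw [← fhV_exact_descent q₀ hq P G hG]; exact h0
    have ih := fh_decided n (lettersLinIndep_mono q₀ hq hL) _ hM0
    have heq : KZ.of (fhR q₀ hq (n + 1) P).rep
        = (KZ.of (fhR q₀ hq (n + 1) P).rep - KZ.of (fhR q₀ hq n (mergedNum q₀ n G)).rep)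
          + KZ.of (fhR q₀ hq n (mergedNum q₀ n G)).rep := by abel
    rw [heq]
    exact add_mem hrel ih

/-- **THEOREM B in the binders of 26322** (`Q = q₀ + ∏ xᵢ`, every numerator, `N = 0`). [folklore] -/
theorem fermatHyperbolic_mem_relations_of_linIndep (hL : LettersLinIndep q₀ hq n) (q : IntegralRep n)
    (P : MvPolynomial (Fin n) ℚ)
    (hd : q.domain = Set.pi Set.univ (fun _ : Fin n => Set.Icc (0:ℝ) 1))
    (hf : ∀ z ∈ Set.pi Set.univ (fun _ : Fin n => Set.Icc (0:ℝ) 1),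
      q.integrand z = MvPolynomial.aeval z P
        / MvPolynomial.aeval z (C q₀ + ∏ i, X i : MvPolynomial (Fin n) ℚ))
    (h0 : q.value = 0) : of q ∈ relations := by
  have hQ : ∀ z ∈ Set.pi Set.univ (fun _ : Fin n => Set.Icc (0:ℝ) 1),
      MvPolynomial.aeval z (C q₀ + ∏ i, X i : MvPolynomial (Fin n) ℚ) ≠ 0 := by
    intro z hz
    rw [← fhQ_eq]
    exact fhQ_ne_zero_of q₀ hq z (by rw [KZ.cube_eq_pi]; exact hz)
  have hqT := of_sub_cubeRFun_mem q P _ hd hQ hf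
  have hTR : KZ.of (cubeRFun P _ hQ).rep - KZ.of (fhR q₀ hq n P).rep ∈ KZ.relations :=
    RFun.rel_of_eqOn fun x _ => by
      show aeval x P / aeval x (C q₀ + ∏ i, X i) = aeval x P / aeval x (fhQ n q₀)
      rw [fhQ_eq]
  have hval : fhV q₀ hq n P = 0 := by
    unfold fhV
    rw [← eval_of, ← eval_eq_of_sub_mem hTR, ← eval_eq_of_sub_mem hqT, eval_of, h0]
  have hR := fh_decided q₀ hq n hL P hval
  have heq : of q = (of q - KZ.of (cubeRFun P _ hQ).rep)
      + (KZ.of (cubeRFun P _ hQ).rep - KZ.of (fhR q₀ hq n P).rep) + KZ.of (fhR q₀ hq n P).rep := by abel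
  rw [heq]
  exact add_mem (add_mem hqT hTR) hR

/-- 26322's own conclusion on the tower, `SingleAt`-free: `∃ N, [π]^N·[q] ∈ relations` with `N = 0`.
[folklore] -/
theorem fermatHyperbolic_single_of_linIndep (hL : LettersLinIndep q₀ hq n) (q : IntegralRep n)
    (P : MvPolynomial (Fin n) ℚ)
    (hd : q.domain = Set.pi Set.univ (fun _ : Fin n => Set.Icc (0:ℝ) 1))
    (hf : ∀ z ∈ Set.pi Set.univ (fun _ : Fin n => Set.Icc (0:ℝ) 1),
      q.integrand z = MvPolynomial.aeval z P
        / MvPolynomial.aeval z (C q₀ + ∏ i, X i : MvPolynomial (Fin n) ℚ))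
    (h0 : q.value = 0) : ∃ N : ℕ, (fun y : FormalRep => of piRep * y)^[N] (of q) ∈ relations :=
  ⟨0, fermatHyperbolic_mem_relations_of_linIndep q₀ hq hL q P hd hf h0⟩

/-- **§9's generic residual on the tower is DISCHARGED by the Diophantine input** (vacuously: under
`LettersLinIndep q₀ (n+1)` a tower representation of value `0` has `Λ(P) = 0`). [folklore] -/
theorem fermatHyperbolicResidual_of_linIndep (hL : LettersLinIndep q₀ hq (n + 1)) :
    FermatHyperbolicResidual n q₀ := by
  intro q P _ hd _ hf h0
  exact fermatHyperbolic_single_of_linIndep q₀ hq hL q P hd hf h0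

/-- **§9's residual at level `n` from the newness of ONE letter**: if `L_{n+1}(q₀) ∉ ℚ + Σ_{j≤n} ℚ·L_j(q₀)`
then `FermatHyperbolicResidual n q₀` holds — VACUOUSLY (no tower representation of value `0` has
`Λ ≠ 0`). For `n = 1` (`Q = q₀ + xy`, the dimension-2 census class) the input is
`Li_2(−1/q₀) ∉ ℚ + ℚ·log(1 + 1/q₀)`, a theorem for integers `q₀ ≥ 5 ∨ q₀ ≤ −6`. [folklore] -/
theorem fermatHyperbolicResidual_of_topLetterNew (hN : TopLetterNew q₀ hq n) :
    FermatHyperbolicResidual n q₀ := by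
  intro q P hP hd hQ hf h0
  have hqT := of_sub_cubeRFun_mem q P _ hd hQ hf
  have hTR : KZ.of (cubeRFun P _ hQ).rep - KZ.of (fhR q₀ hq (n + 1) P).rep ∈ KZ.relations :=
    RFun.rel_of_eqOn fun x _ => by
      show aeval x P / aeval x (C q₀ + ∏ i, X i) = aeval x P / aeval x (fhQ (n + 1) q₀)
      rw [fhQ_eq]
  have hval : fhV q₀ hq (n + 1) P = 0 := by
    unfold fhV
    rw [← eval_of, ← eval_eq_of_sub_mem hTR, ← eval_eq_of_sub_mem hqT, eval_of, h0]
  exact absurd (diagAltm_eq_zero_of_value_of_new q₀ hq hN P hval) hP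

/-! ### The first letter -/

/-- **`L_1(q₀) = ∫₀¹ dx/(q₀ + x) = log((q₀ + 1)/q₀) = −Li_1(−1/q₀)`** (the dimension-`1` instance of
`LettersArePolylogs`, PROVED). [folklore] -/
theorem letter_one : letter q₀ hq 1 = Real.log ((q₀ + 1) / q₀) := by
  have hmp := MeasureTheory.volume_preserving_funUnique (Fin 1) ℝ
  have hpre : KZ.cube 1 = MeasurableEquiv.funUnique (Fin 1) ℝ ⁻¹' Set.Icc 0 1 := by
    ext x
    rw [KZ.mem_cube, Set.mem_preimage, Set.mem_Icc, Fin.forall_fin_one]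
    rfl
  have hfn : ∀ x : Fin 1 → ℝ, (fhR q₀ hq 1 1).fn x = ((q₀ : ℝ) + x 0)⁻¹ := by
    intro x
    rw [fhR_fn, aeval_fhQ, map_one, Fin.prod_univ_one, one_div]
  have h1 := hmp.setIntegral_preimage_emb (MeasurableEquiv.measurableEmbedding _)
    (fun t : ℝ => ((q₀ : ℝ) + t)⁻¹) (Set.Icc 0 1)
  have hI : ∫ t in (0:ℝ)..1, ((q₀ : ℝ) + t)⁻¹ = Real.log ((q₀ + 1) / q₀) := by
    have h0 : (0:ℝ) ∉ Set.uIcc (q₀ : ℝ) (q₀ + 1) := by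
      rcases hq with h | h
      · have : (0:ℝ) < q₀ := by exact_mod_cast h
        rw [Set.uIcc_of_le (by linarith)]
        intro hm
        linarith [hm.1]
      · have : (q₀ : ℝ) < -1 := by exact_mod_cast h
        rw [Set.uIcc_of_le (by linarith)]
        intro hm
        linarith [hm.2]
    have hc : ∫ t in (0:ℝ)..1, (fun s : ℝ => s⁻¹) ((q₀ : ℝ) + t)
        = ∫ s in (q₀ : ℝ) + 0..(q₀ : ℝ) + 1, (fun s : ℝ => s⁻¹) s :=
      intervalIntegral.integral_comp_add_left (f := fun s : ℝ => s⁻¹) (q₀ : ℝ)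
    simp only [add_zero] at hc
    rw [hc, integral_inv h0]
  unfold letter fhV
  rw [value_rep_eq, setIntegral_congr_fun KZ.measurableSet_cube (fun x _ => hfn x), hpre, ← hI,
    intervalIntegral.integral_of_le zero_le_one, ← integral_Icc_eq_integral_Ioc, ← h1]
  rfl

end Diophantine
end Summit.KontsevichZagierPeriods.RootDecompRationalCubeDichotomy.Rung26322.RankDescent
end
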